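import Summits.ValiantsHypothesis.ValiantsHypothesis.Theorems.SymPencilPerFourPeeledCornerGenSwapPairs
import Summits.ValiantsHypothesis.ValiantsHypothesis.Theorems.SymPencilPerFourPeeledCornerGenSwapSamePair
import Summits.ValiantsHypothesis.ValiantsHypothesis.Theorems.SymPencilPerFourPeeledCornerSwapAll

/-!
# Route `SymPencil` — `2 | 2` inner rank of `per_4`, PEELED case at `≤ 11` squares: the
# GENERALIZED-SWAP CORNER for EVERY pair of pairs, off the same-pair locus (`--supports`
# stmt-ValiantsHypothesis-5674 `SdcSuperquadratic`; (8,8) column, cell (8,8,11); memo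
# `NOTE-p6g16-5674-corner-double-swap.md` Remark (iii) with four parameters;
# `NOTE-p8g15-5674-R2-two-pencil.md` §9.6 "the one known gap")

**Theorem** (`false_of_double_genswap`).  There is no reduced peeled family on `≤ 11` squares
(non-zero weights) whose two corrections are GENERALIZED swaps
`t(a,0)(x,0) = (u₀a_ix_j + w₀a_jx_i)·v₀`, `t(0,b)(0,x) = (u₁b_kx_l + w₁b_lx_k)·v₀'`
(`i ≠ j`, `k ≠ l`, `u₀w₀u₁w₁ ≠ 0`) — provided, when the two pairs coincide, the products of the
coefficients sitting on the same positions do not cancel: `u₀u₁ + w₀w₁ ≠ 0` if `(k,l) = (i,j)`,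
`u₀w₁ + w₀u₁ ≠ 0` if `(k,l) = (j,i)` (on that locus the flattening has rank `8` and the corner
method is silent; the coverage side never lands there, memo §9.6).  Assembly as in
`…CornerSwapAll` (val-lit-p6 g17): `transport_genswap` along a simultaneous coordinate
permutation, `…CornerSwapAll.exists_perm_01`, and the dispatch `false_of_genswap01` on the second
pair (same pair: `…CornerGenSwapSamePair`; `{2,3}`, `{0,2}`: `…CornerGenSwapPairs`; `{0,3}`,
`{1,2}`, `{1,3}` moved onto `{0,2}` by `(23)`, `(01)`, `(01)(23)`; reversed orders are the same
correction with `u, w` exchanged).  This is the corner half of the interface "frameless ⇒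
generalized swap with exceptional ratio" for the (8,8,11) coverage theorem.

Honest framing: corner bookkeeping; the cell (8,8,11) still needs the COVERAGE theorem and the
off-locus certificate for exceptional ratios; `28 ≤ sdc(per_4) ≤ 29` of record, the crux
`SdcSuperquadratic` and `VP ≠ VNP` are untouched.  No definitions, no named facts. [folklore]
-/

noncomputable section

-- single-conjunct layout: Sub = Summit, duplicated namespace component intended
set_option linter.dupNamespace false

namespace Summit.ValiantsHypothesis.ValiantsHypothesis.Theorems.SymPencilPerFourPeeledCornerGenSwapAll

open Matrix Finset Module
open Summit.ValiantsHypothesis.ValiantsHypothesis.Theorems.SymPencilPerFourPeeledTransport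
open Summit.ValiantsHypothesis.ValiantsHypothesis.Theorems.SymPencilPerFourPeeledCornerGenSwapSamePair
open Summit.ValiantsHypothesis.ValiantsHypothesis.Theorems.SymPencilPerFourPeeledCornerGenSwapPairs
open Summit.ValiantsHypothesis.ValiantsHypothesis.Theorems.SymPencilPerFourPeeledCornerSwapAll

universe u v

variable {K : Type u} [Field K]

/-- **Transport of a generalized-swap family along a coordinate permutation**:
`t'_r((a,b),(y,z)) := t_r((a∘π, b∘π),(y∘π, z∘π))` is again a reduced peeled family with the same
weights and `v₀, v₀'`, its corrections sitting on `(π i, π j)` and `(π k, π l)`. [folklore] -/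
theorem transport_genswap {κ : Type v} [Fintype κ] (π : Equiv.Perm (Fin 4)) (c : κ → K)
    (t : κ → (((Fin 4 → K) × (Fin 4 → K)) →ₗ[K] ((Fin 4 → K) × (Fin 4 → K)) →ₗ[K] K))
    (hJ : ∀ a b y₂ y₃ : Fin 4 → K,
      ∑ r, c r * (t r (a, b) (y₂, y₃)) ^ 2 = (Matrix.of ![a, b, y₂, y₃]).permanent)
    (v₀ v₀' : κ → K) (hv₀ : ∀ (a x : Fin 4 → K), ∃ s : K, (fun r => t r (a, 0) (x, 0)) = s • v₀)
    (hv₀' : ∀ (b x : Fin 4 → K), ∃ s : K, (fun r => t r (0, b) (0, x)) = s • v₀')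
    (hpeel : ∃ a b y z : Fin 4 → K, ∑ r, c r * t r (a, 0) (y, 0) * t r (0, b) (0, z) ≠ 0)
    (u₀ w₀ u₁ w₁ : K) (i j k l : Fin 4)
    (hψ : ∀ (a x : Fin 4 → K) r, t r (a, 0) (x, 0) = (u₀ * a i * x j + w₀ * a j * x i) * v₀ r)
    (hψ' : ∀ (b x : Fin 4 → K) r, t r (0, b) (0, x) = (u₁ * b k * x l + w₁ * b l * x k) * v₀' r) :
    ∃ t' : κ → (((Fin 4 → K) × (Fin 4 → K)) →ₗ[K] ((Fin 4 → K) × (Fin 4 → K)) →ₗ[K] K),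
      (∀ a b y₂ y₃ : Fin 4 → K,
        ∑ r, c r * (t' r (a, b) (y₂, y₃)) ^ 2 = (Matrix.of ![a, b, y₂, y₃]).permanent) ∧
      (∀ (a x : Fin 4 → K), ∃ s : K, (fun r => t' r (a, 0) (x, 0)) = s • v₀) ∧
      (∀ (b x : Fin 4 → K), ∃ s : K, (fun r => t' r (0, b) (0, x)) = s • v₀') ∧
      (∃ a b y z : Fin 4 → K, ∑ r, c r * t' r (a, 0) (y, 0) * t' r (0, b) (0, z) ≠ 0) ∧
      (∀ (a x : Fin 4 → K) r,
        t' r (a, 0) (x, 0) = (u₀ * a (π i) * x (π j) + w₀ * a (π j) * x (π i)) * v₀ r) ∧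
      (∀ (b x : Fin 4 → K) r,
        t' r (0, b) (0, x) = (u₁ * b (π k) * x (π l) + w₁ * b (π l) * x (π k)) * v₀' r) := by
  classical
  let L : ((Fin 4 → K) × (Fin 4 → K)) →ₗ[K] ((Fin 4 → K) × (Fin 4 → K)) :=
    (LinearMap.funLeft K K π).prodMap (LinearMap.funLeft K K π)
  let t' : κ → (((Fin 4 → K) × (Fin 4 → K)) →ₗ[K] ((Fin 4 → K) × (Fin 4 → K)) →ₗ[K] K) :=
    fun r => (t r).compl₁₂ L L
  have ht' : ∀ r (a b y z : Fin 4 → K), t' r (a, b) (y, z) = t r (a ∘ π, b ∘ π) (y ∘ π, z ∘ π) :=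
    fun r a b y z => rfl
  have z0 : ((0 : Fin 4 → K) ∘ π) = 0 := rfl
  refine ⟨t', fun a b y₂ y₃ => ?_, fun a x => ?_, fun b x => ?_, ?_, fun a x r => ?_, fun b x r => ?_⟩
  · simp only [ht']
    rw [hJ, per_comp_perm]
  · obtain ⟨s, hs⟩ := hv₀ (a ∘ π) (x ∘ π)
    exact ⟨s, by simpa only [ht', z0] using hs⟩
  · obtain ⟨s, hs⟩ := hv₀' (b ∘ π) (x ∘ π)
    exact ⟨s, by simpa only [ht', z0] using hs⟩
  · obtain ⟨a, b, y, z, hne⟩ := hpeel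
    refine ⟨a ∘ π.symm, b ∘ π.symm, y ∘ π.symm, z ∘ π.symm, ?_⟩
    have hc : ∀ w : Fin 4 → K, (w ∘ π.symm) ∘ π = w := fun w => by
      funext i; simp
    simpa only [ht', z0, hc] using hne
  · simp only [ht', z0, hψ, Function.comp_apply]
  · simp only [ht', z0, hψ', Function.comp_apply]

/-- **Dispatch on the second pair** when the first generalized swap sits on `(0,1)`. [folklore] -/
theorem false_of_genswap01 [CharZero K] {κ : Type v} [Fintype κ] [DecidableEq κ]
    (hκ : Fintype.card κ ≤ 11) (c : κ → K) (hc : ∀ r, c r ≠ 0)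
    (t : κ → (((Fin 4 → K) × (Fin 4 → K)) →ₗ[K] ((Fin 4 → K) × (Fin 4 → K)) →ₗ[K] K))
    (hJ : ∀ a b y₂ y₃ : Fin 4 → K,
      ∑ r, c r * (t r (a, b) (y₂, y₃)) ^ 2 = (Matrix.of ![a, b, y₂, y₃]).permanent)
    (v₀ v₀' : κ → K) (hv₀ : ∀ (a x : Fin 4 → K), ∃ s : K, (fun r => t r (a, 0) (x, 0)) = s • v₀)
    (hv₀' : ∀ (b x : Fin 4 → K), ∃ s : K, (fun r => t r (0, b) (0, x)) = s • v₀')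
    (hpeel : ∃ a b y z : Fin 4 → K, ∑ r, c r * t r (a, 0) (y, 0) * t r (0, b) (0, z) ≠ 0)
    (u₀ w₀ u₁ w₁ : K) (hu₀ : u₀ ≠ 0) (hw₀ : w₀ ≠ 0) (hu₁ : u₁ ≠ 0) (hw₁ : w₁ ≠ 0)
    (k l : Fin 4) (hkl : k ≠ l)
    (hloc : (k = 0 ∧ l = 1 → u₀ * u₁ + w₀ * w₁ ≠ 0) ∧ (k = 1 ∧ l = 0 → u₀ * w₁ + w₀ * u₁ ≠ 0))
    (hψ : ∀ (a x : Fin 4 → K) r, t r (a, 0) (x, 0) = (u₀ * a 0 * x 1 + w₀ * a 1 * x 0) * v₀ r)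
    (hψ' : ∀ (b x : Fin 4 → K) r, t r (0, b) (0, x) = (u₁ * b k * x l + w₁ * b l * x k) * v₀' r) :
    False := by
  -- the five different pairs with `k < l`, for arbitrary non-zero coefficients
  have norm : ∀ (t : κ → (((Fin 4 → K) × (Fin 4 → K)) →ₗ[K] ((Fin 4 → K) × (Fin 4 → K)) →ₗ[K] K))
      (u₀ w₀ u₁ w₁ : K), u₀ ≠ 0 → w₀ ≠ 0 → u₁ ≠ 0 → w₁ ≠ 0 →
      (∀ a b y₂ y₃ : Fin 4 → K,
        ∑ r, c r * (t r (a, b) (y₂, y₃)) ^ 2 = (Matrix.of ![a, b, y₂, y₃]).permanent) →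
      (∀ (a x : Fin 4 → K), ∃ s : K, (fun r => t r (a, 0) (x, 0)) = s • v₀) →
      (∀ (b x : Fin 4 → K), ∃ s : K, (fun r => t r (0, b) (0, x)) = s • v₀') →
      (∃ a b y z : Fin 4 → K, ∑ r, c r * t r (a, 0) (y, 0) * t r (0, b) (0, z) ≠ 0) →
      (∀ (a x : Fin 4 → K) r, t r (a, 0) (x, 0) = (u₀ * a 0 * x 1 + w₀ * a 1 * x 0) * v₀ r) →
      ∀ k l : Fin 4, ((k = 2 ∧ l = 3) ∨ (k = 0 ∧ l = 2) ∨ (k = 0 ∧ l = 3) ∨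
        (k = 1 ∧ l = 2) ∨ (k = 1 ∧ l = 3)) →
      (∀ (b x : Fin 4 → K) r, t r (0, b) (0, x) = (u₁ * b k * x l + w₁ * b l * x k) * v₀' r) →
      False := by
    intro t u₀ w₀ u₁ w₁ hu₀ hw₀ hu₁ hw₁ hJ hv₀ hv₀' hpeel hψ k l hkl hψ'
    rcases hkl with ⟨rfl, rfl⟩ | ⟨rfl, rfl⟩ | ⟨rfl, rfl⟩ | ⟨rfl, rfl⟩ | ⟨rfl, rfl⟩
    · exact false_of_genswap01_core hκ c t hJ v₀ v₀' hv₀ hv₀' hpeel u₀ w₀ u₁ w₁ hu₀ hw₀ hu₁ hw₁ 2 3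
        (Or.inl ⟨rfl, rfl⟩) hψ hψ'
    · exact false_of_genswap01_core hκ c t hJ v₀ v₀' hv₀ hv₀' hpeel u₀ w₀ u₁ w₁ hu₀ hw₀ hu₁ hw₁ 0 2
        (Or.inr ⟨rfl, rfl⟩) hψ hψ'
    · -- `{0,3}`: transport along `(2 3)`
      obtain ⟨t', hJ', hx₀, hx₀', hpeel', hφ, hφ'⟩ := transport_genswap (Equiv.swap (2 : Fin 4) 3) c t
        hJ v₀ v₀' hv₀ hv₀' hpeel u₀ w₀ u₁ w₁ 0 1 0 3 hψ hψ'
      have e0 : Equiv.swap (2 : Fin 4) 3 0 = 0 := by decide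
      have e1 : Equiv.swap (2 : Fin 4) 3 1 = 1 := by decide
      have e3 : Equiv.swap (2 : Fin 4) 3 3 = 2 := by decide
      simp only [e0, e1, e3] at hφ hφ'
      exact false_of_genswap01_core hκ c t' hJ' v₀ v₀' hx₀ hx₀' hpeel' u₀ w₀ u₁ w₁ hu₀ hw₀ hu₁ hw₁
        0 2 (Or.inr ⟨rfl, rfl⟩) hφ hφ'
    · -- `{1,2}`: transport along `(0 1)`; the first correction has `u₀, w₀` exchanged
      obtain ⟨t', hJ', hx₀, hx₀', hpeel', hφ, hφ'⟩ := transport_genswap (Equiv.swap (0 : Fin 4) 1) c t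
        hJ v₀ v₀' hv₀ hv₀' hpeel u₀ w₀ u₁ w₁ 0 1 1 2 hψ hψ'
      have e0 : Equiv.swap (0 : Fin 4) 1 0 = 1 := by decide
      have e1 : Equiv.swap (0 : Fin 4) 1 1 = 0 := by decide
      have e2 : Equiv.swap (0 : Fin 4) 1 2 = 2 := by decide
      simp only [e0, e1, e2] at hφ hφ'
      exact false_of_genswap01_core hκ c t' hJ' v₀ v₀' hx₀ hx₀' hpeel' w₀ u₀ u₁ w₁ hw₀ hu₀ hu₁ hw₁
        0 2 (Or.inr ⟨rfl, rfl⟩) (fun a x r => by rw [hφ]; ring) hφ'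
    · -- `{1,3}`: transport along `(0 1)(2 3)`
      obtain ⟨t', hJ', hx₀, hx₀', hpeel', hφ, hφ'⟩ :=
        transport_genswap (Equiv.swap (0 : Fin 4) 1 * Equiv.swap (2 : Fin 4) 3) c t hJ v₀ v₀' hv₀
          hv₀' hpeel u₀ w₀ u₁ w₁ 0 1 1 3 hψ hψ'
      have e0 : (Equiv.swap (0 : Fin 4) 1 * Equiv.swap (2 : Fin 4) 3) 0 = 1 := by decide
      have e1 : (Equiv.swap (0 : Fin 4) 1 * Equiv.swap (2 : Fin 4) 3) 1 = 0 := by decide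
      have e3 : (Equiv.swap (0 : Fin 4) 1 * Equiv.swap (2 : Fin 4) 3) 3 = 2 := by decide
      simp only [e0, e1, e3] at hφ hφ'
      exact false_of_genswap01_core hκ c t' hJ' v₀ v₀' hx₀ hx₀' hpeel' w₀ u₀ u₁ w₁ hw₀ hu₀ hu₁ hw₁
        0 2 (Or.inr ⟨rfl, rfl⟩) (fun a x r => by rw [hφ]; ring) hφ'
  -- reversed orders are the same correction with `u₁, w₁` exchanged
  have hψ'' : ∀ (b x : Fin 4 → K) r,
      t r (0, b) (0, x) = (w₁ * b l * x k + u₁ * b k * x l) * v₀' r :=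
    fun b x r => by rw [hψ']; ring
  fin_cases k <;> fin_cases l
  all_goals first
    | exact absurd rfl hkl
    | exact false_of_double_genswap_same_pair hκ c hc t hJ v₀ v₀' hv₀ hv₀' hpeel u₀ w₀ u₁ w₁
        hu₀ hw₀ hu₁ hw₁ (hloc.1 ⟨rfl, rfl⟩) hψ hψ'
    | exact false_of_double_genswap_same_pair hκ c hc t hJ v₀ v₀' hv₀ hv₀' hpeel u₀ w₀ w₁ u₁
        hu₀ hw₀ hw₁ hu₁ (hloc.2 ⟨rfl, rfl⟩) hψ hψ''
    | exact norm t u₀ w₀ u₁ w₁ hu₀ hw₀ hu₁ hw₁ hJ hv₀ hv₀' hpeel hψ _ _ (by decide) hψ'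
    | exact norm t u₀ w₀ w₁ u₁ hu₀ hw₀ hw₁ hu₁ hJ hv₀ hv₀' hpeel hψ _ _ (by decide) hψ''

/-- ★★ **The generalized-swap corner is empty for every pair of pairs, off the same-pair locus.**
See the module docstring. [folklore] -/
theorem false_of_double_genswap [CharZero K] {κ : Type v} [Fintype κ] [DecidableEq κ]
    (hκ : Fintype.card κ ≤ 11) (c : κ → K) (hc : ∀ r, c r ≠ 0)
    (t : κ → (((Fin 4 → K) × (Fin 4 → K)) →ₗ[K] ((Fin 4 → K) × (Fin 4 → K)) →ₗ[K] K))
    (hJ : ∀ a b y₂ y₃ : Fin 4 → K,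
      ∑ r, c r * (t r (a, b) (y₂, y₃)) ^ 2 = (Matrix.of ![a, b, y₂, y₃]).permanent)
    (v₀ v₀' : κ → K) (hv₀ : ∀ (a x : Fin 4 → K), ∃ s : K, (fun r => t r (a, 0) (x, 0)) = s • v₀)
    (hv₀' : ∀ (b x : Fin 4 → K), ∃ s : K, (fun r => t r (0, b) (0, x)) = s • v₀')
    (hpeel : ∃ a b y z : Fin 4 → K, ∑ r, c r * t r (a, 0) (y, 0) * t r (0, b) (0, z) ≠ 0)
    (u₀ w₀ u₁ w₁ : K) (hu₀ : u₀ ≠ 0) (hw₀ : w₀ ≠ 0) (hu₁ : u₁ ≠ 0) (hw₁ : w₁ ≠ 0)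
    (i j k l : Fin 4) (hij : i ≠ j) (hkl : k ≠ l)
    (hloc : (k = i ∧ l = j → u₀ * u₁ + w₀ * w₁ ≠ 0) ∧ (k = j ∧ l = i → u₀ * w₁ + w₀ * u₁ ≠ 0))
    (hψ : ∀ (a x : Fin 4 → K) r, t r (a, 0) (x, 0) = (u₀ * a i * x j + w₀ * a j * x i) * v₀ r)
    (hψ' : ∀ (b x : Fin 4 → K) r, t r (0, b) (0, x) = (u₁ * b k * x l + w₁ * b l * x k) * v₀' r) :
    False := by
  obtain ⟨π, hπi, hπj⟩ := exists_perm_01 i j hij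
  obtain ⟨t', hJ', hx₀, hx₀', hpeel', hφ, hφ'⟩ :=
    transport_genswap π c t hJ v₀ v₀' hv₀ hv₀' hpeel u₀ w₀ u₁ w₁ i j k l hψ hψ'
  simp only [hπi, hπj] at hφ
  refine false_of_genswap01 hκ c hc t' hJ' v₀ v₀' hx₀ hx₀' hpeel' u₀ w₀ u₁ w₁ hu₀ hw₀ hu₁ hw₁
    (π k) (π l) (fun h => hkl (π.injective h)) ⟨fun ⟨h0, h1⟩ => hloc.1 ⟨?_, ?_⟩,
      fun ⟨h1, h0⟩ => hloc.2 ⟨?_, ?_⟩⟩ hφ hφ'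
  · exact π.injective (h0.trans hπi.symm)
  · exact π.injective (h1.trans hπj.symm)
  · exact π.injective (h1.trans hπj.symm)
  · exact π.injective (h0.trans hπi.symm)

end Summit.ValiantsHypothesis.ValiantsHypothesis.Theorems.SymPencilPerFourPeeledCornerGenSwapAll

end
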